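import Mathlib.Topology.NoetherianSpace
import Mathlib.Topology.Sober
import Mathlib.AlgebraicGeometry.Properties
import HarnessLib

/-!
# Closed sets with the same generizations of a point agree near that point (Noetherian sober spaces)

Route `ResolutionOfSingularities/WeightedInvariant`, door crux `HypersurfaceCentreConstruction`
(stmt-ResolutionOfSingularities-19897), helper (summit-side, OURS) — the «XS lemma» of the H2c″ assembly's sub-stub
[S3] (gluing the canonical centre from local presentations: the stratum `V(P)` given by (strat) at a point and the
global maximum locus have the same generizations of the point, hence coincide on a neighbourhood). Pure topology:

* `exists_isOpen_forall_exists_specializes` — in a Noetherian quasi-sober space, every point `x` has an open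
  neighbourhood `U` such that every point of the closed set `Z` in `U` is a specialization of a generization of `x`
  lying in `Z` (drop the finitely many irreducible components of `Z` missing `x`; the others have generic points
  specializing to `x`);
* `exists_isOpen_inter_eq_of_forall_specializes` — two closed sets containing the same generizations of `x` agree on
  an open neighbourhood of `x`;
* `exists_opens_inter_eq_of_forall_specializes` — the same on (the carrier of) a scheme with Noetherian
  underlying space (e.g. quasi-compact and locally Noetherian).

AI-written; weaker than expert review. [folklore]
-/

open TopologicalSpace Topology

set_option linter.dupNamespace false -- mandated namespace of this single-conjunct summit

namespace Summit.ResolutionOfSingularities.ResolutionOfSingularities.Theorems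

universe u

section Topology

variable {X : Type u} [TopologicalSpace X] [NoetherianSpace X] [QuasiSober X]

/-- **Near `x`, a closed set of a Noetherian sober space consists of specializations of generizations of `x`**:
there is an open `U ∋ x` such that every `z ∈ Z ∩ U` satisfies `η ⤳ z` for some `η ∈ Z` with `η ⤳ x` (take `U` =
complement of the irreducible components of `Z` not containing `x`; `η` = the generic point of a component through
`z`, which then contains `x`). [folklore] -/
theorem exists_isOpen_forall_exists_specializes {Z : Set X} (hZ : IsClosed Z) (x : X) :
    ∃ U : Set X, IsOpen U ∧ x ∈ U ∧ ∀ z ∈ Z ∩ U, ∃ η ∈ Z, η ⤳ x ∧ η ⤳ z := by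
  obtain ⟨S, hSf, hSc, hSi, hZS⟩ := NoetherianSpace.exists_finite_set_isClosed_irreducible hZ
  refine ⟨(⋃ t ∈ {t ∈ S | x ∉ t}, t)ᶜ, ?_, ?_, ?_⟩
  · rw [isOpen_compl_iff]
    exact (hSf.subset (Set.sep_subset _ _)).isClosed_biUnion fun t ht => hSc t ht.1
  · simp only [Set.mem_compl_iff, Set.mem_iUnion, Set.mem_setOf_eq, not_exists]
    exact fun t ht hxt => (ht.2 hxt).elim
  · rintro z ⟨hzZ, hzU⟩
    rw [hZS] at hzZ
    obtain ⟨t, htS, hzt⟩ := Set.mem_sUnion.mp hzZ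
    have hxt : x ∈ t := by
      by_contra hxt
      exact hzU (Set.mem_biUnion (show t ∈ {t ∈ S | x ∉ t} from ⟨htS, hxt⟩) hzt)
    have hgen := (hSi t htS).isGenericPoint_genericPoint (hSc t htS)
    refine ⟨(hSi t htS).genericPoint, ?_, hgen.specializes hxt, hgen.specializes hzt⟩
    rw [hZS]
    exact Set.mem_sUnion.mpr ⟨t, htS, hgen.mem⟩

/-- **Two closed sets with the same generizations of a point agree on a neighbourhood of it** (Noetherian sober
space): if for every `η ⤳ x` one has `η ∈ Z₁ ↔ η ∈ Z₂`, then `Z₁ ∩ U = Z₂ ∩ U` for some open `U ∋ x`. [folklore] -/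
theorem exists_isOpen_inter_eq_of_forall_specializes {Z₁ Z₂ : Set X} (h₁ : IsClosed Z₁) (h₂ : IsClosed Z₂)
    (x : X) (h : ∀ η : X, η ⤳ x → (η ∈ Z₁ ↔ η ∈ Z₂)) :
    ∃ U : Set X, IsOpen U ∧ x ∈ U ∧ Z₁ ∩ U = Z₂ ∩ U := by
  obtain ⟨U₁, hU₁, hx₁, H₁⟩ := exists_isOpen_forall_exists_specializes h₁ x
  obtain ⟨U₂, hU₂, hx₂, H₂⟩ := exists_isOpen_forall_exists_specializes h₂ x
  refine ⟨U₁ ∩ U₂, hU₁.inter hU₂, ⟨hx₁, hx₂⟩, Set.ext fun z => ⟨?_, ?_⟩⟩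
  · rintro ⟨hz, hzU₁, hzU₂⟩
    obtain ⟨η, hη, hηx, hηz⟩ := H₁ z ⟨hz, hzU₁⟩
    exact ⟨hηz.mem_closed h₂ ((h η hηx).mp hη), hzU₁, hzU₂⟩
  · rintro ⟨hz, hzU₁, hzU₂⟩
    obtain ⟨η, hη, hηx, hηz⟩ := H₂ z ⟨hz, hzU₂⟩
    exact ⟨hηz.mem_closed h₁ ((h η hηx).mpr hη), hzU₁, hzU₂⟩

end Topology

/-- **Scheme form**: on a scheme whose underlying space is Noetherian (e.g. quasi-compact and locally Noetherian), two
closed subsets with the same generizations of a point `y` agree on an open neighbourhood of `y`. [folklore] -/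
theorem exists_opens_inter_eq_of_forall_specializes {Y : AlgebraicGeometry.Scheme.{u}}
    [NoetherianSpace Y] (Z₁ Z₂ : Closeds Y) (y : Y)
    (h : ∀ η : Y, η ⤳ y → (η ∈ Z₁ ↔ η ∈ Z₂)) :
    ∃ U : Y.Opens, y ∈ U ∧ (Z₁ : Set Y) ∩ U = (Z₂ : Set Y) ∩ U := by
  obtain ⟨U, hU, hyU, hZU⟩ :=
    exists_isOpen_inter_eq_of_forall_specializes Z₁.isClosed Z₂.isClosed y (fun η hη => h η hη)
  exact ⟨⟨U, hU⟩, hyU, hZU⟩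

end Summit.ResolutionOfSingularities.ResolutionOfSingularities.Theorems
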